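import Literature.Probability.Distributions.PoissonBinomialTilting
import HarnessLib

/-!
# Chernoff bounds for a Poisson-binomial law: `P(S ≥ μ + t), P(S ≤ μ − t) ≤ exp(−t²/(4μ))` for `0 ≤ t ≤ 2μ`

Measure-free exponential tail bounds for the law `q = PoissonBinomial.pmf ps` of a sum `S` of independent Bernoulli
variables with parameters in `[0,1]` and mean `μ = Σ p` (Lange's table), from the tilting normaliser of
`PoissonBinomialTilting.lean` (`M(λ) = Π((1−p)+pλ) = E[λ^S]`):

* §1 **`sum_pow_mul_pmf_eq_tiltNorm`**: `Σ_k λ^k q(k) = M(λ)` (`λ > 0`) — the moment generating function;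
  `tiltNorm_nonneg`, **`tiltNorm_le_exp`**: `M(λ) ≤ exp((λ−1)μ)` for `λ ≥ 0` (`1 + y ≤ e^y` factorwise).
* §2 **`upperTail_mul_pow_le_tiltNorm`** / **`lowerTail_mul_pow_le_tiltNorm`**: Markov's inequality on `λ^S`:
  `λ^a·P(S ≥ a) ≤ M(λ)` (`λ ≥ 1`) and `λ^a·P(S ≤ a) ≤ M(λ)` (`0 < λ ≤ 1`), `a ∈ ℕ`.
* §3 **`upperTail_le_exp`**, **`lowerTail_le_exp`** (THE CHERNOFF BOUNDS): for `0 < μ`, `0 ≤ t ≤ 2μ`,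
  `P(S ≥ μ + t) ≤ exp(−t²/(4μ))` and `P(S ≤ μ − t) ≤ exp(−t²/(4μ))` (tilt `λ = e^{±s}`, `s = t/(2μ) ≤ 1`,
  `|e^x − 1 − x| ≤ x²` on `[−1,1]`) [Durrett 2019, §2.7 (Cramér / Chernoff: exponential Markov after tilting);
  the constant `4` instead of the variance-sharp `2V` is the price of `e^x − 1 − x ≤ x²`].
* §4 (v2) **`hyperGen_upperTail_le_exp`**, **`hyperGen_lowerTail_le_exp`** — the same for the coefficients of the hypergeometric
  generating polynomial `H_{b,d,r}` (`μ = rb/(b+d)`, total mass `C(b+d,r)`), via the Bernoulli-sum representation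
  [Vatutin–Mikhailov 1983, §2]: the currency of the shell-law mixture components (`ShellLawGeneratingPolynomial` §3).
* §5 (v3) **`upperTail_le_exp_param`** (`P(S ≥ a) ≤ exp((u+u²)μ − ua)` for every `u ∈ [0,1]`, no restriction on `a`),
  `upperTail_le_exp_half` (`t ≥ 2μ ⇒ P(S ≥ μ+t) ≤ e^{−t/2}`), **`upperTail_le_exp_min`** (`P(S ≥ μ+t) ≤ exp(−(t/2)·min(1, t/(2μ)))`, all `t ≥ 0`).
* §6 (v4) **`lowerTail_le_exp_param`** (`P(S ≤ a) ≤ exp((u²−u)μ + ua)`, any `u ∈ [0,1]`, any `a`) and its hypergeometric-currency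
  version `hyperGen_lowerTail_le_exp_param` (the upper-tail analogue `hyperGen_upperTail_le_exp_param` lives in `LevelZeroShellLawTail.lean`).

Purely algebraic (finite sums over `ℝ`). Cell pnp-psdrank (prover g23, MEMO-26 §3): this is the [TAIL] input of Theorems brick
121 `ChebyshevTracialDesignVirtualPositivityCriterion` — the shell laws of block statistics are mixtures of shifted
hypergeometric = Poisson-binomial laws (`ShellLawGeneratingPolynomial` §3, `RealRootedBernoulliSum`), so their tails outside
`|x − μ| ≤ K√(nD)` are `≤ e^{−K²D}` — and it prices the weight of the badly centred components in the [BULK] input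
(`PoissonBinomialTilting` §8). All PROVED, 0 sorry, no definitions, no named facts.

## References
* [Durrett2019] R. Durrett, *Probability: Theory and Examples*, 5th ed. (2019), §2.7 (large deviations: the tilted
  distribution and the exponential Chebyshev/Markov bound), Thm. 1.6.4.
* [Lange2010] K. Lange, *Numerical Analysis for Statisticians* (2010), §1.7 eq. (1.4).
* [VatutinMikhailov1983] V. A. Vatutin, V. G. Mikhailov, Theory Probab. Appl. 27 (1983) 734–743, §2.
-/

namespace Literature.Probability.Distributions

open Finset Polynomial
open Literature.Combinatorics.StablePolynomials (coeff_bernoulliProd_eq_pmf hyperGen exists_bernoulliProd_eq_hyperGen sum_eq_of_hyperGen_eq)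

namespace PoissonBinomial

/-! ## §1 The moment generating function is the tilting normaliser; `M(λ) ≤ exp((λ−1)μ)` -/

/-- **`E[λ^S] = M(λ)`**: `Σ_{k ≤ N} λ^k·q(k) = Π_k((1−p_k) + p_kλ)` for `λ > 0`. [cite: Durrett2019, §2.7] -/
theorem sum_pow_mul_pmf_eq_tiltNorm (l : ℝ) (hl : 0 < l) (ps : List ℝ) (hps : ∀ p ∈ ps, 0 ≤ p ∧ p ≤ 1) :
    ∑ k ∈ range (ps.length + 1), l ^ k * pmf ps k = tiltNorm l ps := by
  have h : ∀ k ∈ range (ps.length + 1), l ^ k * pmf ps k = pmf (tilt l ps) k * tiltNorm l ps :=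
    fun k _ => (pmf_tilt_mul_tiltNorm l hl ps hps k).symm
  rw [sum_congr rfl h, ← sum_mul, ← length_tilt l ps, sum_pmf, one_mul]

/-- The normaliser is nonnegative for `λ ≥ 0`. [cite: Durrett2019, §2.7] -/
theorem tiltNorm_nonneg (l : ℝ) (hl : 0 ≤ l) :
    ∀ ps : List ℝ, (∀ p ∈ ps, 0 ≤ p ∧ p ≤ 1) → 0 ≤ tiltNorm l ps
  | [], _ => by simp
  | p :: ps, h => by
    have hp := h p (by simp)
    rw [tiltNorm_cons]
    exact mul_nonneg (by nlinarith [hp.1, hp.2]) (tiltNorm_nonneg l hl ps fun q hq => h q (by simp [hq]))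

/-- **`M(λ) ≤ exp((λ−1)μ)`** for `λ ≥ 0` (`μ = Σ p`): each factor `1 + p(λ−1) ≤ e^{p(λ−1)}`. [cite: Durrett2019, §2.7] -/
theorem tiltNorm_le_exp (l : ℝ) (hl : 0 ≤ l) :
    ∀ ps : List ℝ, (∀ p ∈ ps, 0 ≤ p ∧ p ≤ 1) → tiltNorm l ps ≤ Real.exp ((l - 1) * ps.sum)
  | [], _ => by simp
  | p :: ps, h => by
    have hp := h p (by simp)
    have hps : ∀ q ∈ ps, 0 ≤ q ∧ q ≤ 1 := fun q hq => h q (by simp [hq])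
    have ih := tiltNorm_le_exp l hl ps hps
    rw [tiltNorm_cons, List.sum_cons, mul_add, Real.exp_add]
    have hfac : 1 - p + p * l ≤ Real.exp ((l - 1) * p) := by
      have := Real.add_one_le_exp ((l - 1) * p); linarith
    exact mul_le_mul hfac ih (tiltNorm_nonneg l hl ps hps) (Real.exp_pos _).le

/-! ## §2 Markov's inequality on `λ^S` -/

/-- **Upper tail, Markov form**: `λ^a · Σ_{k ≥ a} q(k) ≤ M(λ)` for `λ ≥ 1`. [cite: Durrett2019, §2.7] -/
theorem upperTail_mul_pow_le_tiltNorm (l : ℝ) (hl : 1 ≤ l) (ps : List ℝ) (hps : ∀ p ∈ ps, 0 ≤ p ∧ p ≤ 1) (a : ℕ) :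
    l ^ a * ∑ k ∈ (range (ps.length + 1)).filter (fun k => a ≤ k), pmf ps k ≤ tiltNorm l ps := by
  have hl0 : 0 < l := by linarith
  have hq0 := pmf_nonneg ps hps
  rw [← sum_pow_mul_pmf_eq_tiltNorm l hl0 ps hps, mul_sum]
  calc ∑ k ∈ (range (ps.length + 1)).filter (fun k => a ≤ k), l ^ a * pmf ps k
      ≤ ∑ k ∈ (range (ps.length + 1)).filter (fun k => a ≤ k), l ^ k * pmf ps k :=
        sum_le_sum fun k hk => mul_le_mul_of_nonneg_right (pow_le_pow_right₀ hl (mem_filter.1 hk).2) (hq0 k)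
    _ ≤ ∑ k ∈ range (ps.length + 1), l ^ k * pmf ps k :=
        sum_le_sum_of_subset_of_nonneg (filter_subset _ _) fun k _ _ => mul_nonneg (pow_nonneg hl0.le _) (hq0 k)

/-- **Lower tail, Markov form**: `λ^a · Σ_{k ≤ a} q(k) ≤ M(λ)` for `0 < λ ≤ 1`. [cite: Durrett2019, §2.7] -/
theorem lowerTail_mul_pow_le_tiltNorm (l : ℝ) (hl0 : 0 < l) (hl : l ≤ 1) (ps : List ℝ) (hps : ∀ p ∈ ps, 0 ≤ p ∧ p ≤ 1)
    (a : ℕ) :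
    l ^ a * ∑ k ∈ (range (ps.length + 1)).filter (fun k => k ≤ a), pmf ps k ≤ tiltNorm l ps := by
  have hq0 := pmf_nonneg ps hps
  rw [← sum_pow_mul_pmf_eq_tiltNorm l hl0 ps hps, mul_sum]
  calc ∑ k ∈ (range (ps.length + 1)).filter (fun k => k ≤ a), l ^ a * pmf ps k
      ≤ ∑ k ∈ (range (ps.length + 1)).filter (fun k => k ≤ a), l ^ k * pmf ps k :=
        sum_le_sum fun k hk => mul_le_mul_of_nonneg_right (pow_le_pow_of_le_one hl0.le hl (mem_filter.1 hk).2) (hq0 k)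
    _ ≤ ∑ k ∈ range (ps.length + 1), l ^ k * pmf ps k :=
        sum_le_sum_of_subset_of_nonneg (filter_subset _ _) fun k _ _ => mul_nonneg (pow_nonneg hl0.le _) (hq0 k)

/-! ## §3 The Chernoff bounds -/

/-- **CHERNOFF UPPER TAIL**: `P(S ≥ μ + t) ≤ exp(−t²/(4μ))` for `0 < μ = Σ p` and `0 ≤ t ≤ 2μ`.
[cite: Durrett2019, §2.7 (Chernoff's exponential Markov bound after tilting)] -/
theorem upperTail_le_exp (ps : List ℝ) (hps : ∀ p ∈ ps, 0 ≤ p ∧ p ≤ 1) (hμ : 0 < ps.sum) {t : ℝ} (ht0 : 0 ≤ t)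
    (ht : t ≤ 2 * ps.sum) :
    ∑ k ∈ (range (ps.length + 1)).filter (fun k : ℕ => ps.sum + t ≤ (k : ℝ)), pmf ps k ≤
      Real.exp (-(t ^ 2 / (4 * ps.sum))) := by
  set μ := ps.sum with hμdef
  set s := t / (2 * μ) with hs
  have hs0 : 0 ≤ s := div_nonneg ht0 (by linarith)
  have hs1 : s ≤ 1 := by rw [hs, div_le_one (by linarith)]; exact ht
  set l := Real.exp s with hldef
  have hl1 : 1 ≤ l := by rw [hldef]; exact Real.one_le_exp hs0
  have hl0 : 0 < l := Real.exp_pos s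
  have hq0 := pmf_nonneg ps hps
  -- Markov on `e^{sS}` with the real threshold `μ + t`
  set P := ∑ k ∈ (range (ps.length + 1)).filter (fun k : ℕ => μ + t ≤ (k : ℝ)), pmf ps k with hP
  have hmarkov : Real.exp (s * (μ + t)) * P ≤ tiltNorm l ps := by
    rw [hP, mul_sum, ← sum_pow_mul_pmf_eq_tiltNorm l hl0 ps hps]
    calc ∑ k ∈ (range (ps.length + 1)).filter (fun k : ℕ => μ + t ≤ (k : ℝ)), Real.exp (s * (μ + t)) * pmf ps k
        ≤ ∑ k ∈ (range (ps.length + 1)).filter (fun k : ℕ => μ + t ≤ (k : ℝ)), l ^ k * pmf ps k := by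
          refine sum_le_sum fun k hk => mul_le_mul_of_nonneg_right ?_ (hq0 k)
          rw [hldef, ← Real.exp_nat_mul, mul_comm (k : ℝ)]
          exact Real.exp_le_exp.2 (mul_le_mul_of_nonneg_left (mem_filter.1 hk).2 hs0)
      _ ≤ ∑ k ∈ range (ps.length + 1), l ^ k * pmf ps k :=
          sum_le_sum_of_subset_of_nonneg (filter_subset _ _) fun k _ _ => mul_nonneg (pow_nonneg hl0.le _) (hq0 k)
  have hM := tiltNorm_le_exp l hl0.le ps hps
  -- `P ≤ exp((l−1)μ − s(μ+t)) ≤ exp(−t²/(4μ))`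
  have hexp : (l - 1) * μ - s * (μ + t) ≤ -(t ^ 2 / (4 * μ)) := by
    have h1 : l - 1 ≤ s + s ^ 2 := by
      have := (le_abs_self _).trans (Real.abs_exp_sub_one_sub_id_le (show |s| ≤ 1 by rw [abs_of_nonneg hs0]; exact hs1))
      rw [hldef]; linarith
    have h2 : (l - 1) * μ ≤ (s + s ^ 2) * μ := mul_le_mul_of_nonneg_right h1 hμ.le
    have h3 : (s + s ^ 2) * μ - s * (μ + t) = -(t ^ 2 / (4 * μ)) := by
      rw [hs]; field_simp; ring
    linarith
  have hPle : P ≤ Real.exp ((l - 1) * μ - s * (μ + t)) := by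
    rw [Real.exp_sub, le_div_iff₀ (Real.exp_pos _), mul_comm]
    exact hmarkov.trans hM
  exact hPle.trans (Real.exp_le_exp.2 hexp)

/-- **CHERNOFF LOWER TAIL**: `P(S ≤ μ − t) ≤ exp(−t²/(4μ))` for `0 < μ = Σ p` and `0 ≤ t ≤ 2μ`.
[cite: Durrett2019, §2.7 (Chernoff's exponential Markov bound after tilting)] -/
theorem lowerTail_le_exp (ps : List ℝ) (hps : ∀ p ∈ ps, 0 ≤ p ∧ p ≤ 1) (hμ : 0 < ps.sum) {t : ℝ} (ht0 : 0 ≤ t)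
    (ht : t ≤ 2 * ps.sum) :
    ∑ k ∈ (range (ps.length + 1)).filter (fun k : ℕ => (k : ℝ) ≤ ps.sum - t), pmf ps k ≤
      Real.exp (-(t ^ 2 / (4 * ps.sum))) := by
  set μ := ps.sum with hμdef
  set s := t / (2 * μ) with hs
  have hs0 : 0 ≤ s := div_nonneg ht0 (by linarith)
  have hs1 : s ≤ 1 := by rw [hs, div_le_one (by linarith)]; exact ht
  set l := Real.exp (-s) with hldef
  have hl1 : l ≤ 1 := by rw [hldef]; exact Real.exp_le_one_iff.2 (by linarith)
  have hl0 : 0 < l := Real.exp_pos _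
  have hq0 := pmf_nonneg ps hps
  set P := ∑ k ∈ (range (ps.length + 1)).filter (fun k : ℕ => (k : ℝ) ≤ μ - t), pmf ps k with hP
  have hmarkov : Real.exp (-s * (μ - t)) * P ≤ tiltNorm l ps := by
    rw [hP, mul_sum, ← sum_pow_mul_pmf_eq_tiltNorm l hl0 ps hps]
    calc ∑ k ∈ (range (ps.length + 1)).filter (fun k : ℕ => (k : ℝ) ≤ μ - t), Real.exp (-s * (μ - t)) * pmf ps k
        ≤ ∑ k ∈ (range (ps.length + 1)).filter (fun k : ℕ => (k : ℝ) ≤ μ - t), l ^ k * pmf ps k := by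
          refine sum_le_sum fun k hk => mul_le_mul_of_nonneg_right ?_ (hq0 k)
          rw [hldef, ← Real.exp_nat_mul, mul_comm (k : ℝ)]
          exact Real.exp_le_exp.2 (by nlinarith [(mem_filter.1 hk).2, hs0])
      _ ≤ ∑ k ∈ range (ps.length + 1), l ^ k * pmf ps k :=
          sum_le_sum_of_subset_of_nonneg (filter_subset _ _) fun k _ _ => mul_nonneg (pow_nonneg hl0.le _) (hq0 k)
  have hM := tiltNorm_le_exp l hl0.le ps hps
  have hexp : (l - 1) * μ - (-s * (μ - t)) ≤ -(t ^ 2 / (4 * μ)) := by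
    have h1 : l - 1 ≤ -s + s ^ 2 := by
      have := (le_abs_self _).trans (Real.abs_exp_sub_one_sub_id_le (show |(-s)| ≤ 1 by rw [abs_neg, abs_of_nonneg hs0]; exact hs1))
      rw [hldef]; nlinarith
    have h2 : (l - 1) * μ ≤ (-s + s ^ 2) * μ := mul_le_mul_of_nonneg_right h1 hμ.le
    have h3 : (-s + s ^ 2) * μ - (-s * (μ - t)) = -(t ^ 2 / (4 * μ)) := by
      rw [hs]; field_simp; ring
    linarith
  have hPle : P ≤ Real.exp ((l - 1) * μ - (-s * (μ - t))) := by
    rw [Real.exp_sub, le_div_iff₀ (Real.exp_pos _), mul_comm]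
    exact hmarkov.trans hM
  exact hPle.trans (Real.exp_le_exp.2 hexp)

/-! ## §4 The hypergeometric instance (coefficients of `H_{b,d,r}`) -/

/-- **Chernoff upper tail for a hypergeometric law** in generating-polynomial currency: with `μ = rb/(b+d) > 0` and
`0 ≤ t ≤ 2μ`, `Σ_{k ≤ r, μ + t ≤ k} coeff_k(H_{b,d,r}) ≤ C(b+d,r)·exp(−t²/(4μ))` — via the Bernoulli-sum representation of the
hypergeometric law (tree `exists_bernoulliProd_eq_hyperGen`, `sum_eq_of_hyperGen_eq`). [cite: VatutinMikhailov1983, §2]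
[cite: Durrett2019, §2.7] -/
theorem hyperGen_upperTail_le_exp {b d r : ℕ} (hr : r ≤ b + d) (hμ : 0 < (r : ℝ) * b / ((b : ℝ) + d)) {t : ℝ}
    (ht0 : 0 ≤ t) (ht : t ≤ 2 * ((r : ℝ) * b / ((b : ℝ) + d))) :
    ∑ k ∈ (range (r + 1)).filter (fun k : ℕ => (r : ℝ) * b / ((b : ℝ) + d) + t ≤ (k : ℝ)), (hyperGen b d r).coeff k ≤
      (((b + d).choose r : ℕ) : ℝ) * Real.exp (-(t ^ 2 / (4 * ((r : ℝ) * b / ((b : ℝ) + d))))) := by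
  obtain ⟨ps, hps0, hlen, hG⟩ := exists_bernoulliProd_eq_hyperGen hr
  have hps : ∀ p ∈ ps, 0 ≤ p ∧ p ≤ 1 := fun p hp => ⟨(hps0 p hp).1.le, (hps0 p hp).2⟩
  have hmean : ps.sum = (r : ℝ) * b / ((b : ℝ) + d) := sum_eq_of_hyperGen_eq hr hlen hG
  have hcoef : ∀ k, (hyperGen b d r).coeff k = (((b + d).choose r : ℕ) : ℝ) * pmf ps k := by
    intro k; rw [hG, coeff_C_mul, coeff_bernoulliProd_eq_pmf]
  rw [← hmean] at hμ ht ⊢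
  have htail := upperTail_le_exp ps hps hμ ht0 ht
  -- pass from `range (r+1)` to `range (|ps|+1)`: the extra indices carry zero mass
  have hsum : ∑ k ∈ (range (r + 1)).filter (fun k : ℕ => ps.sum + t ≤ (k : ℝ)), (hyperGen b d r).coeff k =
      (((b + d).choose r : ℕ) : ℝ) * ∑ k ∈ (range (ps.length + 1)).filter (fun k : ℕ => ps.sum + t ≤ (k : ℝ)), pmf ps k := by
    rw [mul_sum, sum_congr rfl fun k _ => hcoef k]
    symm
    refine sum_subset (fun k hk => ?_) (fun k hk hk' => ?_)
    · rw [mem_filter, mem_range] at hk ⊢; exact ⟨by omega, hk.2⟩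
    · rw [mem_filter, mem_range] at hk hk'
      have hlt : ps.length < k := by
        by_contra h; exact hk' ⟨by omega, hk.2⟩
      rw [pmf_eq_zero_of_length_lt ps k hlt, mul_zero]
  rw [hsum]
  exact mul_le_mul_of_nonneg_left htail (by positivity)

/-- **Chernoff lower tail for a hypergeometric law**: with `μ = rb/(b+d) > 0` and `0 ≤ t ≤ 2μ`,
`Σ_{k ≤ r, k ≤ μ − t} coeff_k(H_{b,d,r}) ≤ C(b+d,r)·exp(−t²/(4μ))`. [cite: VatutinMikhailov1983, §2] [cite: Durrett2019, §2.7] -/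
theorem hyperGen_lowerTail_le_exp {b d r : ℕ} (hr : r ≤ b + d) (hμ : 0 < (r : ℝ) * b / ((b : ℝ) + d)) {t : ℝ}
    (ht0 : 0 ≤ t) (ht : t ≤ 2 * ((r : ℝ) * b / ((b : ℝ) + d))) :
    ∑ k ∈ (range (r + 1)).filter (fun k : ℕ => (k : ℝ) ≤ (r : ℝ) * b / ((b : ℝ) + d) - t), (hyperGen b d r).coeff k ≤
      (((b + d).choose r : ℕ) : ℝ) * Real.exp (-(t ^ 2 / (4 * ((r : ℝ) * b / ((b : ℝ) + d))))) := by
  obtain ⟨ps, hps0, hlen, hG⟩ := exists_bernoulliProd_eq_hyperGen hr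
  have hps : ∀ p ∈ ps, 0 ≤ p ∧ p ≤ 1 := fun p hp => ⟨(hps0 p hp).1.le, (hps0 p hp).2⟩
  have hmean : ps.sum = (r : ℝ) * b / ((b : ℝ) + d) := sum_eq_of_hyperGen_eq hr hlen hG
  have hcoef : ∀ k, (hyperGen b d r).coeff k = (((b + d).choose r : ℕ) : ℝ) * pmf ps k := by
    intro k; rw [hG, coeff_C_mul, coeff_bernoulliProd_eq_pmf]
  rw [← hmean] at hμ ht ⊢
  have htail := lowerTail_le_exp ps hps hμ ht0 ht
  have hsum : ∑ k ∈ (range (r + 1)).filter (fun k : ℕ => (k : ℝ) ≤ ps.sum - t), (hyperGen b d r).coeff k =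
      (((b + d).choose r : ℕ) : ℝ) * ∑ k ∈ (range (ps.length + 1)).filter (fun k : ℕ => (k : ℝ) ≤ ps.sum - t), pmf ps k := by
    rw [mul_sum, sum_congr rfl fun k _ => hcoef k]
    symm
    refine sum_subset (fun k hk => ?_) (fun k hk hk' => ?_)
    · rw [mem_filter, mem_range] at hk ⊢; exact ⟨by omega, hk.2⟩
    · rw [mem_filter, mem_range] at hk hk'
      have hlt : ps.length < k := by
        by_contra h; exact hk' ⟨by omega, hk.2⟩
      rw [pmf_eq_zero_of_length_lt ps k hlt, mul_zero]
  rw [hsum]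
  exact mul_le_mul_of_nonneg_left htail (by positivity)

/-! ## §5 The parametrised upper tail (no restriction `t ≤ 2μ`) and the large-deviation regime -/

/-- **Parametrised Chernoff upper tail**: for every `u ∈ [0,1]` and every real threshold `a`,
`P(S ≥ a) ≤ exp((u + u²)μ − u·a)` (`M(e^u) ≤ e^{(e^u−1)μ} ≤ e^{(u+u²)μ}`). [cite: Durrett2019, §2.7] -/
theorem upperTail_le_exp_param (ps : List ℝ) (hps : ∀ p ∈ ps, 0 ≤ p ∧ p ≤ 1) {u : ℝ} (hu0 : 0 ≤ u) (hu1 : u ≤ 1)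
    (a : ℝ) :
    ∑ k ∈ (range (ps.length + 1)).filter (fun k : ℕ => a ≤ (k : ℝ)), pmf ps k ≤
      Real.exp ((u + u ^ 2) * ps.sum - u * a) := by
  set μ := ps.sum with hμdef
  set l := Real.exp u with hldef
  have hl0 : 0 < l := Real.exp_pos u
  have hq0 := pmf_nonneg ps hps
  set P := ∑ k ∈ (range (ps.length + 1)).filter (fun k : ℕ => a ≤ (k : ℝ)), pmf ps k with hP
  have hmarkov : Real.exp (u * a) * P ≤ tiltNorm l ps := by
    rw [hP, mul_sum, ← sum_pow_mul_pmf_eq_tiltNorm l hl0 ps hps]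
    calc ∑ k ∈ (range (ps.length + 1)).filter (fun k : ℕ => a ≤ (k : ℝ)), Real.exp (u * a) * pmf ps k
        ≤ ∑ k ∈ (range (ps.length + 1)).filter (fun k : ℕ => a ≤ (k : ℝ)), l ^ k * pmf ps k := by
          refine sum_le_sum fun k hk => mul_le_mul_of_nonneg_right ?_ (hq0 k)
          rw [hldef, ← Real.exp_nat_mul, mul_comm (k : ℝ)]
          exact Real.exp_le_exp.2 (mul_le_mul_of_nonneg_left (mem_filter.1 hk).2 hu0)
      _ ≤ ∑ k ∈ range (ps.length + 1), l ^ k * pmf ps k :=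
          sum_le_sum_of_subset_of_nonneg (filter_subset _ _) fun k _ _ => mul_nonneg (pow_nonneg hl0.le _) (hq0 k)
  have hM := tiltNorm_le_exp l hl0.le ps hps
  have hμ0 : 0 ≤ μ := by
    rw [hμdef]; exact List.sum_nonneg (fun p hp => (hps p hp).1)
  have hexp : (l - 1) * μ ≤ (u + u ^ 2) * μ := by
    refine mul_le_mul_of_nonneg_right ?_ hμ0
    have := (le_abs_self _).trans (Real.abs_exp_sub_one_sub_id_le (show |u| ≤ 1 by rw [abs_of_nonneg hu0]; exact hu1))
    rw [hldef]; linarith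
  have hPle : P ≤ Real.exp ((l - 1) * μ - u * a) := by
    rw [Real.exp_sub, le_div_iff₀ (Real.exp_pos _), mul_comm]
    exact hmarkov.trans hM
  exact hPle.trans (Real.exp_le_exp.2 (by linarith))

/-- **Large-deviation regime**: for `t ≥ 2μ`, `P(S ≥ μ + t) ≤ exp(−t/2)` (`u = 1` in the parametrised bound). [cite: Durrett2019, §2.7] -/
theorem upperTail_le_exp_half (ps : List ℝ) (hps : ∀ p ∈ ps, 0 ≤ p ∧ p ≤ 1) {t : ℝ} (ht : 2 * ps.sum ≤ t) :
    ∑ k ∈ (range (ps.length + 1)).filter (fun k : ℕ => ps.sum + t ≤ (k : ℝ)), pmf ps k ≤ Real.exp (-(t / 2)) := by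
  have h := upperTail_le_exp_param ps hps (le_of_lt zero_lt_one) le_rfl (ps.sum + t)
  refine h.trans (Real.exp_le_exp.2 ?_)
  have hμ0 : 0 ≤ ps.sum := List.sum_nonneg (fun p hp => (hps p hp).1)
  nlinarith

/-- **Uniform two-regime upper tail**: for every `t ≥ 0`, `P(S ≥ μ + t) ≤ exp(−(t/2)·min(1, t/(2μ)))` when `μ > 0`.
[cite: Durrett2019, §2.7] -/
theorem upperTail_le_exp_min (ps : List ℝ) (hps : ∀ p ∈ ps, 0 ≤ p ∧ p ≤ 1) (hμ : 0 < ps.sum) {t : ℝ} (ht0 : 0 ≤ t) :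
    ∑ k ∈ (range (ps.length + 1)).filter (fun k : ℕ => ps.sum + t ≤ (k : ℝ)), pmf ps k ≤
      Real.exp (-(t / 2 * min 1 (t / (2 * ps.sum)))) := by
  rcases le_or_gt t (2 * ps.sum) with h | h
  · have h1 : t / (2 * ps.sum) ≤ 1 := by rw [div_le_one (by linarith)]; exact h
    rw [min_eq_right h1]
    refine (upperTail_le_exp ps hps hμ ht0 h).trans (Real.exp_le_exp.2 (le_of_eq ?_))
    field_simp; ring
  · have h1 : 1 ≤ t / (2 * ps.sum) := by rw [le_div_iff₀ (by linarith)]; linarith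
    rw [min_eq_left h1, mul_one]
    exact upperTail_le_exp_half ps hps h.le

/-! ## §6 The parametrised lower tail -/

/-- **Parametrised Chernoff lower tail**: for every `u ∈ [0,1]` and every real threshold `a`,
`P(S ≤ a) ≤ exp((u² − u)μ + u·a)` (`M(e^{−u}) ≤ e^{(e^{−u}−1)μ} ≤ e^{(u²−u)μ}`); with `a = μ − t` this is `exp(u²μ − ut)`.
[cite: Durrett2019, §2.7] -/
theorem lowerTail_le_exp_param (ps : List ℝ) (hps : ∀ p ∈ ps, 0 ≤ p ∧ p ≤ 1) {u : ℝ} (hu0 : 0 ≤ u) (hu1 : u ≤ 1)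
    (a : ℝ) :
    ∑ k ∈ (range (ps.length + 1)).filter (fun k : ℕ => (k : ℝ) ≤ a), pmf ps k ≤
      Real.exp ((u ^ 2 - u) * ps.sum + u * a) := by
  set μ := ps.sum with hμdef
  set l := Real.exp (-u) with hldef
  have hl0 : 0 < l := Real.exp_pos _
  have hq0 := pmf_nonneg ps hps
  set P := ∑ k ∈ (range (ps.length + 1)).filter (fun k : ℕ => (k : ℝ) ≤ a), pmf ps k with hP
  have hmarkov : Real.exp (-u * a) * P ≤ tiltNorm l ps := by
    rw [hP, mul_sum, ← sum_pow_mul_pmf_eq_tiltNorm l hl0 ps hps]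
    calc ∑ k ∈ (range (ps.length + 1)).filter (fun k : ℕ => (k : ℝ) ≤ a), Real.exp (-u * a) * pmf ps k
        ≤ ∑ k ∈ (range (ps.length + 1)).filter (fun k : ℕ => (k : ℝ) ≤ a), l ^ k * pmf ps k := by
          refine sum_le_sum fun k hk => mul_le_mul_of_nonneg_right ?_ (hq0 k)
          rw [hldef, ← Real.exp_nat_mul, mul_comm (k : ℝ)]
          exact Real.exp_le_exp.2 (by nlinarith [(mem_filter.1 hk).2, hu0])
      _ ≤ ∑ k ∈ range (ps.length + 1), l ^ k * pmf ps k :=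
          sum_le_sum_of_subset_of_nonneg (filter_subset _ _) fun k _ _ => mul_nonneg (pow_nonneg hl0.le _) (hq0 k)
  have hM := tiltNorm_le_exp l hl0.le ps hps
  have hμ0 : 0 ≤ μ := by
    rw [hμdef]; exact List.sum_nonneg (fun p hp => (hps p hp).1)
  have hexp : (l - 1) * μ ≤ (u ^ 2 - u) * μ := by
    refine mul_le_mul_of_nonneg_right ?_ hμ0
    have := (le_abs_self _).trans (Real.abs_exp_sub_one_sub_id_le (show |(-u)| ≤ 1 by rw [abs_neg, abs_of_nonneg hu0]; exact hu1))
    rw [hldef]; nlinarith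
  have hPle : P ≤ Real.exp ((l - 1) * μ - (-u * a)) := by
    rw [Real.exp_sub, le_div_iff₀ (Real.exp_pos _), mul_comm]
    exact hmarkov.trans hM
  exact hPle.trans (Real.exp_le_exp.2 (by linarith))

/-- **Parametrised Chernoff lower tail for `H_{b,d,r}`**: `Σ_{k ≤ r, k ≤ θ} coeff_k(H_{b,d,r}) ≤ C(b+d,r)·exp((u²−u)μ + uθ)`,
`μ = rb/(b+d)`, any `u ∈ [0,1]`, real `θ`. [cite: VatutinMikhailov1983, §2] [cite: Durrett2019, §2.7] -/
theorem hyperGen_lowerTail_le_exp_param {b d r : ℕ} (hr : r ≤ b + d) {u : ℝ} (hu0 : 0 ≤ u) (hu1 : u ≤ 1) (θ : ℝ) :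
    ∑ k ∈ (range (r + 1)).filter (fun k : ℕ => (k : ℝ) ≤ θ), (hyperGen b d r).coeff k ≤
      (((b + d).choose r : ℕ) : ℝ) * Real.exp ((u ^ 2 - u) * ((r : ℝ) * b / ((b : ℝ) + d)) + u * θ) := by
  obtain ⟨ps, hps0, hlen, hG⟩ := exists_bernoulliProd_eq_hyperGen hr
  have hps : ∀ p ∈ ps, 0 ≤ p ∧ p ≤ 1 := fun p hp => ⟨(hps0 p hp).1.le, (hps0 p hp).2⟩
  have hmean : ps.sum = (r : ℝ) * b / ((b : ℝ) + d) := sum_eq_of_hyperGen_eq hr hlen hG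
  have hcoef : ∀ k, (hyperGen b d r).coeff k = (((b + d).choose r : ℕ) : ℝ) * pmf ps k := by
    intro k; rw [hG, coeff_C_mul, coeff_bernoulliProd_eq_pmf]
  rw [← hmean]
  have htail := lowerTail_le_exp_param ps hps hu0 hu1 θ
  have hsum : ∑ k ∈ (range (r + 1)).filter (fun k : ℕ => (k : ℝ) ≤ θ), (hyperGen b d r).coeff k =
      (((b + d).choose r : ℕ) : ℝ) * ∑ k ∈ (range (ps.length + 1)).filter (fun k : ℕ => (k : ℝ) ≤ θ), pmf ps k := by
    rw [mul_sum, sum_congr rfl fun k _ => hcoef k]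
    symm
    refine sum_subset (fun k hk => ?_) (fun k hk hk' => ?_)
    · rw [mem_filter, mem_range] at hk ⊢; exact ⟨by omega, hk.2⟩
    · rw [mem_filter, mem_range] at hk hk'
      have hlt : ps.length < k := by
        by_contra h; exact hk' ⟨by omega, hk.2⟩
      rw [pmf_eq_zero_of_length_lt ps k hlt, mul_zero]
  rw [hsum]
  exact mul_le_mul_of_nonneg_left htail (by positivity)

end PoissonBinomial

end Literature.Probability.Distributions
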